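import Summits.AtomisticToContinuum.BoseEinsteinCondensation.Theorems.BECGroundStateSOSPeriodicIRBoundTwoSectorFloatingFreeGas
import HarnessLib

/-!
# Route `BECGroundStateSOS`, crux `PeriodicIRBound` (stmt-AtomisticToContinuum-3972), line `two-sector-gd-transfer`
# (v8 "floating thresholds") — the free-gas constant of the pooled stub S1' is PINNED: `FloatingFor 0 K ρ₀ C → 1/(4π²) ≤ C`

Supports (does not close) stmt-AtomisticToContinuum-3972. Companion of `…TwoSectorFloatingFreeGas.lean`
(`FloatingFreeGas.floatingFor_zero`: the free gas satisfies `FloatingFor 0 K ρ₀ C` for every `C ≥ 1/(4π²)`). Here the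
converse, the registered by-product stub `stub_freeGasFloatingSharp`: for `K, ρ₀, C > 0`, `FloatingFor 0 K ρ₀ C` forces
`C ≥ 1/(4π²)` — the particle channel of the FREE gas at the first shell `n = e₀` is saturated by the exact condensate.

* §1 The condensate `Ψ₀ = (L^{-3/2})^{⊗(m+2)}` (`Negative.twoMode (m+1) hL hn 0`, the `t = 0` member of the landed
  two-mode witness family): all its non-zero-mode occupations vanish (`cellOccupation_conden`, `modeAn_conden`:
  `a_q Ψ₀ = 0`, `q ≠ 0`), its free energy is `0 = E₀` (`periodicEnergy_conden`; so it is a `δ`-near-minimiser for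
  EVERY `δ`), and the free form of
  the one-excitation state is `𝓔_0[a†(φ_n)Ψ₀] = ε_n = |2πn/L|²` exactly (`qform_modeCr_conden`: kinetic Parseval
  `WF.lintegral_kineticDensity_eq_tsum_normSq_modeAn`, the per-mode occupations of the particle state
  `WF.normSq_modeAn_modeCr_planeWaveMode` (CCR), and `a_q Ψ₀ = 0` for `q ≠ 0`, `ε_0 = 0`).
* §2 `one_le_of_chanPlus_zero`: the particle-channel inequality `ChanPlus 0 m L n 0 b` tested at `Ψ₀` reads
  `1 = (n_k + 1)² ≤ b((1+η)ε_n + η)` for every `η > 0`.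
* §3 `floatingFor_zero_sharp`: along `L = L_N(ρ₀/2) → ∞` the first shell `e₀` eventually lies in the window
  `2π/L ≤ K`; `FloatingFor` gives `μ₊ ≥ 0` and `ChanPlus` against `E₀ + μ₊ ≥ 0` with `b = CL²`, hence against `0`
  (`chanPlus_antitone`); with `ε_{e₀} = 4π²/L²`, §2 gives `1 ≤ 4π²C(1+η) + ηCL²` for every `η > 0`, i.e. `1 ≤ 4π²C`.

References (shape only; nothing is cited as a fact): F. J. Dyson, E. H. Lieb, B. Simon, J. Stat. Phys. 18 (1978) 335,
§1 (free bosons saturate Gaussian domination with `b = 1/ε`); T. Kennedy, E. H. Lieb, B. S. Shastry, J. Stat. Phys. 53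
(1988) 1019, (12)–(14); LSSY2005 App. A (mode calculus on the torus).
-/

noncomputable section

open scoped BigOperators ENNReal ComplexConjugate
open Filter MeasureTheory

namespace Summit.AtomisticToContinuum.BoseEinsteinCondensation.Cruxes.PeriodicIRBound.TwoSectorGdTransfer

open Literature.MathematicalPhysics.QuantumManyBody.BoseGas
open Summit.AtomisticToContinuum.BoseEinsteinCondensation.Cruxes.PeriodicIRBound.LinearPhFloorWagner.WF
open Summit.AtomisticToContinuum.BoseEinsteinCondensation.Theorems.GaussianDominationCan.Negative
  (symFun oneBody nsq e0 e0_ne_zero norm_e0 nsq_e0)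
open Summit.AtomisticToContinuum.BoseEinsteinCondensation.Theorems.PeriodicIRBound.Negative
  (twoMode cellOccupation_twoMode periodicEnergy_zero_twoMode)

namespace FloatingSharp

variable {L : ℝ} {m : ℕ} {n : Fin 3 → ℤ}

/-! ## §1 The condensate `Ψ₀ = (L^{-3/2})^{⊗(m+2)}` and the one-excitation state `a†(φ_n)Ψ₀` -/

/-! The condensate is `Negative.twoMode (m+1) hL hn 0 le_rfl zero_le_one : PeriodicTrialState (m+1+1) L`, the
member `t = 0` of the landed witness family `(√((1-t)/L³) + √(t/L³)e_n)^{⊗(m+2)}`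
(Theorems/PeriodicIRBound/Negative/TwoModeStates.lean): the constant function `(L^{-3/2})^{⊗(m+2)}`; the label
`n ≠ 0` is idle at `t = 0`. -/

/-- **No excitations in the condensate**: `n_q(Ψ₀) = 0` for every mode `q ≠ 0` (`Negative.cellOccupation_twoMode` at
`t = 0`, after relabelling the idle mode `n ↦ q` of the constant one-body factor). [folklore] -/
theorem cellOccupation_conden (hL : 0 < L) (hn : n ≠ 0) {q : Fin 3 → ℤ} (hq : q ≠ 0) :
    cellOccupation (m + 1 + 1) L (planeWaveMode L q) (twoMode (m + 1) hL hn 0 le_rfl zero_le_one).ψ = 0 := by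
  have hone : oneBody L n (Real.sqrt ((1 - 0) / L ^ 3)) (Real.sqrt (0 / L ^ 3)) =
      oneBody L q (Real.sqrt ((1 - 0) / L ^ 3)) (Real.sqrt (0 / L ^ 3)) := by
    funext x
    simp [oneBody]
  have hfun : (twoMode (m + 1) hL hn 0 le_rfl zero_le_one).ψ = (twoMode (m + 1) hL hq 0 le_rfl zero_le_one).ψ := by
    show symFun (m + 1) L n _ _ = symFun (m + 1) L q _ _
    rw [symFun, symFun, hone]
  rw [hfun, cellOccupation_twoMode hL hq]
  simp

/-- **`a(φ_q)Ψ₀ = 0` for `q ≠ 0`**: `‖a_qΨ₀‖² = n_q(Ψ₀) = 0` (`WF.normSq_modeAn`) and a continuous periodic function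
with vanishing cell norm vanishes (`WF.eq_zero_of_normSq_eq_zero`, `WF.isCore_modeAn`). [folklore] -/
theorem modeAn_conden (hL : 0 < L) (hn : n ≠ 0) {q : Fin 3 → ℤ} (hq : q ≠ 0) :
    modeAn L (planeWaveMode L q) (twoMode (m + 1) hL hn 0 le_rfl zero_le_one).ψ = 0 := by
  have hc := isCore_modeAn hL q (isCore_trialState (twoMode (m + 1) hL hn 0 le_rfl zero_le_one))
  apply eq_zero_of_normSq_eq_zero hL hc.contDiff.continuous hc.periodic
  rw [normSq_modeAn hL q, cellOccupation_conden hL hn hq]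

/-- **The condensate has zero free energy** (`= E₀(m+2, L)` at `v = 0`), so it is a `δ`-near-minimiser for every
`δ`. [folklore] -/
theorem periodicEnergy_conden (hL : 0 < L) (hn : n ≠ 0) :
    periodicEnergy 0 (twoMode (m + 1) hL hn 0 le_rfl zero_le_one) = 0 := by
  rw [periodicEnergy_zero_twoMode hL hn]
  simp

/-- **Free form of the one-excitation state**: `𝓔_0[a†(φ_n)Ψ₀] = ε_n = |2πn/L|²` for `n ≠ 0`. Kinetic Parseval
`𝓔_0[F] = ∑_q ε_q‖a_qF‖²` (`WF.qform_zero_eq`, `WF.lintegral_kineticDensity_eq_tsum_normSq_modeAn`) and, by the CCR,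
`‖a_q a_n†Ψ₀‖² = ‖a_qΨ₀‖² + ‖a_n a_qΨ₀‖² + [q = n](‖Ψ₀‖² + 2‖a_nΨ₀‖²)`
(`WF.normSq_modeAn_modeCr_planeWaveMode`), which is `[q = n]` for `q ≠ 0` (`modeAn_conden`, `WF.normSq_zero_fun`),
while the `q = 0` term carries `ε_0 = 0`. [cite: LSSY2005, App. A (A.6)–(A.7)] -/
theorem qform_modeCr_conden (hL : 0 < L) (hn : n ≠ 0) :
    qform 0 L (modeCr (planeWaveMode L n) (twoMode (m + 1) hL hn 0 le_rfl zero_le_one).ψ) =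
      ENNReal.ofReal (‖waveVector L n‖ ^ 2) := by
  set Ψ₀ : PeriodicTrialState (m + 1 + 1) L := twoMode (m + 1) hL hn 0 le_rfl zero_le_one with hΨ₀
  have hΨc : IsCore L Ψ₀.ψ := isCore_trialState _
  have hcΨc : IsCore L (modeCr (planeWaveMode L n) Ψ₀.ψ) := isCore_modeCr hL n hΨc
  rw [qform_zero_eq, lintegral_kineticDensity_eq_tsum_normSq_modeAn hL hcΨc, tsum_eq_single n]
  · rw [normSq_modeAn_modeCr_planeWaveMode hL n n hΨc, if_pos rfl, hΨ₀, modeAn_conden hL hn hn, modeAn_zero]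
    have h1 : normSq L Ψ₀.ψ = 1 := Ψ₀.norm_eq
    rw [hΨ₀] at h1
    simp [normSq_zero_fun, h1]
  · intro q hqn
    by_cases hq0 : q = 0
    · subst hq0
      simp
    · rw [normSq_modeAn_modeCr_planeWaveMode hL q n hΨc, if_neg hqn, hΨ₀, modeAn_conden hL hn hq0, modeAn_zero]
      simp [normSq_zero_fun]

/-! ## §2 The particle channel at threshold `0`, tested on the condensate -/

/-- **`ChanPlus 0 m L n 0 b` at the condensate**: for every `η > 0`, `1 ≤ b((1+η)ε_n + η)` — take the slack `δ(η)` of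
the channel inequality, test it at `Ψ₀` (a `δ`-near-minimiser, `periodicEnergy_conden`), and insert `n_k(Ψ₀) = 0`
(`cellOccupation_conden`) and `𝓔_0[a†Ψ₀] = ε_n` (`qform_modeCr_conden`). [cite: KLS1988JSP, (12)] -/
theorem one_le_of_chanPlus_zero (hL : 0 < L) (hn : n ≠ 0) {b : ℝ} (h : ChanPlus 0 m L n 0 b) {η : ℝ}
    (hη : 0 < η) : 1 ≤ b * ((1 + η) * ‖waveVector L n‖ ^ 2 + η) := by
  obtain ⟨δ, _, hΨ⟩ := h η hη
  have key := hΨ (twoMode (m + 1) hL hn 0 le_rfl zero_le_one) (by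
    unfold NearMinAt
    rw [periodicEnergy_conden hL hn]
    exact zero_le)
  simp only at key
  have hocc : (cellOccupation (m + 2) L (planeWaveMode L n)
      (twoMode (m + 1) hL hn 0 le_rfl zero_le_one).ψ).toReal = 0 := by
    rw [cellOccupation_conden hL hn hn, ENNReal.toReal_zero]
  have hq : (qform 0 L (modeCr (planeWaveMode L n) (twoMode (m + 1) hL hn 0 le_rfl zero_le_one).ψ)).toReal =
      ‖waveVector L n‖ ^ 2 := by
    rw [qform_modeCr_conden hL hn, ENNReal.toReal_ofReal (sq_nonneg _)]
  rw [hocc, hq] at key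
  linarith [key]

/-! ## §3 The free-gas constant of S1' is pinned: `FloatingFor 0 K ρ₀ C → 1/(4π²) ≤ C` -/

/-- **Sharpness of S1' at `v = 0`.** If `K, ρ₀, C > 0` and `FloatingFor 0 K ρ₀ C`, then `C ≥ 1/(4π²)`. Proof: at
`ε := 1`, `ρ := ρ₀/2` and an eventually-large `N = m + 2` with `2π/L_N ≤ K` (`tendsto_sideLength_atTop`), the first
shell `n = e₀` (`‖e₀‖_∞ = |e₀|₂ = 1`) lies in the window; `FloatingFor` gives `μ₊ ≥ 0` and the particle channel against
`E₀ + μ₊ ≥ 0` with `b = CL²`, hence against `0` (`chanPlus_antitone`); by `one_le_of_chanPlus_zero` with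
`ε_{e₀} = 4π²/L²`, `1 ≤ 4π²C(1+η) + ηCL²` for every `η > 0`, and `η → 0` (`le_of_forall_pos_le_add`). [cite: DLS1978, §1] -/
theorem floatingFor_zero_sharp {K ρ₀ C : ℝ} (hK : 0 < K) (hρ₀ : 0 < ρ₀) (hC : 0 < C) (hF : FloatingFor 0 K ρ₀ C) :
    1 / (4 * Real.pi ^ 2) ≤ C := by
  have hπ : (0 : ℝ) < 4 * Real.pi ^ 2 := by positivity
  have hρ : 0 < ρ₀ / 2 := half_pos hρ₀
  -- an eventually-large sector `N = m + 2`: the window `2π‖n‖_∞/L ≤ K` contains the first shell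
  have hev := hF 1 one_pos (ρ₀ / 2) hρ (half_lt_self hρ₀)
  have hLev : ∀ᶠ m : ℕ in atTop, 2 * Real.pi / K ≤ sideLength (ρ₀ / 2) (m + 2) :=
    ((tendsto_sideLength_atTop hρ).comp (tendsto_add_atTop_nat 2)).eventually_ge_atTop _
  obtain ⟨m, hm, hmL⟩ := (hev.and hLev).exists
  set L : ℝ := sideLength (ρ₀ / 2) (m + 2) with hLdef
  have hL : 0 < L := sideLength_pos_of_pos hρ (by omega)
  have hwin : 2 * Real.pi / L * ‖(fun j => ((e0 j : ℤ) : ℝ))‖ ≤ K := by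
    rw [norm_e0, mul_one, div_le_iff₀ hL]
    have h := (div_le_iff₀ hK).1 hmL
    linarith
  obtain ⟨μp, _, hμp, -, hP, -⟩ := hm e0 e0_ne_zero hwin
  rw [norm_e0, one_pow, div_one] at hP
  -- lower the threshold `E₀ + μ₊ ≥ 0` to `0`
  have hb : 0 ≤ C * L ^ 2 := by positivity
  have hT : (0 : ℝ) ≤ (periodicGroundStateEnergy 0 (m + 2) L).toReal + μp := add_nonneg ENNReal.toReal_nonneg hμp
  have hP0 : ChanPlus 0 m L e0 0 (C * L ^ 2) := chanPlus_antitone hb hT hP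
  have hε : ‖waveVector L e0‖ ^ 2 = 4 * Real.pi ^ 2 / L ^ 2 := by
    rw [norm_waveVector_sq]
    change 4 * Real.pi ^ 2 * nsq e0 / L ^ 2 = _
    rw [nsq_e0, mul_one]
  -- `1 ≤ 4π²C + ε` for every `ε > 0`
  have hkey : ∀ ε : ℝ, 0 < ε → (1 : ℝ) ≤ 4 * Real.pi ^ 2 * C + ε := by
    intro ε hεpos
    set S : ℝ := 4 * Real.pi ^ 2 * C + C * L ^ 2 with hS
    have hSpos : 0 < S := by positivity
    have h := one_le_of_chanPlus_zero hL e0_ne_zero hP0 (div_pos hεpos hSpos)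
    rw [hε] at h
    have hLne : L ≠ 0 := hL.ne'
    have hSne : S ≠ 0 := hSpos.ne'
    have hcalc : C * L ^ 2 * ((1 + ε / S) * (4 * Real.pi ^ 2 / L ^ 2) + ε / S) = 4 * Real.pi ^ 2 * C + ε := by
      rw [hS] at hSne ⊢
      field_simp
      ring
    linarith [hcalc]
  have h1 : (1 : ℝ) ≤ 4 * Real.pi ^ 2 * C := le_of_forall_pos_le_add hkey
  rw [div_le_iff₀ hπ]
  linarith

/-- **Refuted strengthening**: the free gas does NOT satisfy `FloatingFor 0 K ρ₀ C` with a constant below `1/(4π²)`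
(contrast `FloatingFreeGas.floatingFor_zero`: it does for every `C ≥ 1/(4π²)`). [cite: DLS1978, §1] -/
theorem not_floatingFor_zero_small {K ρ₀ C : ℝ} (hK : 0 < K) (hρ₀ : 0 < ρ₀) (hC : 0 < C)
    (hlt : C < 1 / (4 * Real.pi ^ 2)) : ¬ FloatingFor 0 K ρ₀ C := fun h =>
  absurd (floatingFor_zero_sharp hK hρ₀ hC h) (not_le.2 hlt)

end FloatingSharp

/-- **Registered by-product stub `stub_freeGasFloatingSharp` of the crux ledger** (line `two-sector-gd-transfer`, v8
"floating thresholds"): SHARPNESS of the free-gas instance of the pooled stub S1' — for `K, ρ₀, C > 0`,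
`FloatingFor 0 K ρ₀ C` forces `C ≥ 1/(4π²)` (`FloatingSharp.floatingFor_zero_sharp`; with
`FloatingFreeGas.floatingFor_zero` the free-gas constant of S1' is exactly `1/(4π²)`). [cite: DLS1978, §1] -/
theorem stub_freeGasFloatingSharp : ∀ K ρ₀ C : ℝ, 0 < K → 0 < ρ₀ → 0 < C → FloatingFor 0 K ρ₀ C →
    1 / (4 * Real.pi ^ 2) ≤ C :=
  fun _ _ _ hK hρ₀ hC hF => FloatingSharp.floatingFor_zero_sharp hK hρ₀ hC hF

end Summit.AtomisticToContinuum.BoseEinsteinCondensation.Cruxes.PeriodicIRBound.TwoSectorGdTransfer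

end
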